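import Literature.Barriers.Parity.SiegelZeroDichotomyChowla
import Literature.NumberTheory.Sieve.VaughanMeanValueDecomposition
import HarnessLib

/-!
# Step (v) of Tao–Teräväinen at `k = 0`, algebraic part: Lemma 3.7 (named fact) and the
# expansion of `∏ⱼ λ♯_Siegel(n+h'ⱼ)` into Type I sums

Topic `Literature/Barriers/Parity`, sub-namespace `TaoTeravainen`; part of the proof DAG of
`Literature.Barriers.Parity.TaoTeravainen2021_chowla` (`SiegelZeroDichotomyChowla.lean`), towards the
named fact `TaoTeravainen2021_prop81_k0` (Proposition 8.1 at `k = 0`, `ℓ ≥ 1`: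
`𝔼_{n ≤ x} ∏ⱼ λ♯_Siegel(n+h'ⱼ) ≈ 0`). Contents:

* `TaoTeravainen2021_lemma37_k0` — NAMED FACT: **Lemma 3.7** of the source (the consequence of the
  Weil bound for character sums with polynomial argument plus completion of sums, §3.4) in the
  case used at `k = 0` (`J = {1,…,ℓ}`, `d'ⱼ = dⱼ`, `I = [1, x]`):
  `|∑_{n ≤ x} ∏ⱼ 1_{dⱼ ∣ n+hⱼ} χ((n+hⱼ)/dⱼ)| ≤ C_ε q^{1/2+ε} (d₁⋯d_ℓ, q)^{1/2} (x/(q d₁⋯d_ℓ) + 1)`;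
* PROVED: the Type I coefficient `sharpCoeff` of `λ♯_Siegel = ∑_{de = n} sharpCoeff(d) χ(e)`, its
  support `d < D` (`sharpCoeff_eq_zero_of_le`, from `ψ = 0` off `(-1, 1)`) and size
  `|sharpCoeff(d)| ≤ (sup|ψ|) τ(d)` (`abs_sharpCoeff_le`); the truncated divisor expansion
  `λ♯_Siegel(m) = ∑_{d ≤ N, d ∣ m} sharpCoeff(d) χ(m/d)` (`liouvilleSiegelSharp_eq_sum_Ioc`); and the
  expansion of the correlation into Type I sums
  `∑_{n ≤ x} ∏_{h ∈ H} λ♯_Siegel(n+h) = ∑_{(d_h) ∈ [1,N]^H} (∏_h sharpCoeff(d_h)) ·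
  ∑_{n ≤ x} ∏_h 1_{d_h ∣ n+h} χ((n+h)/d_h)` (`sum_prod_liouvilleSiegelSharp_eq`), the source's
  "Using the decomposition (6.2) to expand `λ♯_Siegel(n+h'_j)`, we can thus write … as
  `∑_{d_{k+1},…,d_{k+ℓ} ≤ D} h_{d}(n) (∏ 1_{dⱼ∣n+hⱼ}) ∏ χ((n+hⱼ)/d'ⱼ)`" at `k = 0`.
  [cite: TaoTeravainen2021, Lemma 3.7 and §8 (the case ℓ > 0)]
-/

noncomputable section

open Finset
open Literature.NumberTheory.Sieve.Vaughan (card_divisors_eq_sum_antidiagonal)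

namespace Literature.Barriers.Parity

open TaoTeravainen

/-! ### Lemma 3.7 at `k = 0` (named fact) -/

/-- **Tao–Teräväinen 2022, Lemma 3.7** (consequence of the Weil bound (3.13) and completion of
sums (3.16)), in the case `k = 0`, `J = {1, …, ℓ}`, `d'ⱼ = dⱼ`, `I = [1, x]`: "Let `d₁, …, d_ℓ` be
natural numbers … Then `𝔼_{n ≤ x} (∏ⱼ 1_{dⱼ ∣ n+hⱼ}) ∏ⱼ χ((n+hⱼ)/dⱼ) ≪_ε
q_χ^{1/2+ε} (d₁⋯d_ℓ, q_χ)^{1/2} (1/(q_χ d₁⋯d_ℓ) + 1/x)` for any `ε > 0`", the constant depending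
on `ε` and the fixed shifts, for the exceptional (primitive quadratic) character `χ` of a Siegel
zero. Rendered (multiplied through by `x`): for fixed distinct shifts `H` (`≥ 1`, non-empty) and
`ε > 0` there is `C` such that for every Siegel zero (`IsSiegelZero χ η`, conductor `q`), every
`x ∈ ℕ` and all `d_h ≥ 1`:
`|∑_{n=1}^{x} ∏_{h ∈ H} 1_{d_h ∣ n+h} χ((n+h)/d_h)| ≤ C q^{1/2+ε} √((∏ d_h, q)) (x/(q ∏ d_h) + 1)`.
A NAMED FACT. [cite: TaoTeravainen2021, Lemma 3.7] -/
def TaoTeravainen2021_lemma37_k0 : Prop :=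
  ∀ H : Finset ℕ, H.Nonempty → (∀ h ∈ H, 1 ≤ h) → ∀ ε : ℝ, 0 < ε →
    ∃ C : ℝ, ∀ (q : ℕ) [NeZero q] (χ : DirichletCharacter ℂ q) (η : ℝ), IsSiegelZero χ η →
      ∀ (x : ℕ) (d : ℕ → ℕ), (∀ h ∈ H, 1 ≤ d h) →
        |∑ n ∈ Icc 1 x, ∏ h ∈ H, (if d h ∣ n + h then realChar χ ((n + h) / d h) else 0)| ≤
          C * (q : ℝ) ^ ((1 : ℝ) / 2 + ε) * Real.sqrt (Nat.gcd (∏ h ∈ H, d h) q) *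
            ((x : ℝ) / ((q : ℝ) * ∏ h ∈ H, (d h : ℝ)) + 1)

namespace TaoTeravainen

/-! ### The Type I coefficient of `λ♯_Siegel` -/

/-- The coefficient `(λ ∗ μχ)_(≤R)(d) ψ_{≤D}(d)` of the Type I sum
`λ♯_Siegel = ((λ ∗ μχ)_(≤R) ψ_{≤D}) ∗ χ` ((6.2)). [cite: TaoTeravainen2021, §6 (6.2)] -/
def sharpCoeff {q : ℕ} (χ : DirichletCharacter ℂ q) (ψ : ℝ → ℝ) (R D : ℝ) (d : ℕ) : ℝ :=
  if d ∈ Nat.smoothNumbers (⌊R⌋₊ + 1) then lamMuChi χ d * ψ (Real.log d / Real.log D) else 0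

/-- `λ♯_Siegel(n) = ∑_{de = n} sharpCoeff(d) χ(e)` (definitional). [cite: TaoTeravainen2021, §6 (6.2)] -/
theorem liouvilleSiegelSharp_eq_sum_sharpCoeff {q : ℕ} (χ : DirichletCharacter ℂ q) (ψ : ℝ → ℝ)
    (R D : ℝ) (n : ℕ) :
    liouvilleSiegelSharp χ ψ R D n =
      ∑ p ∈ n.divisorsAntidiagonal, sharpCoeff χ ψ R D p.1 * realChar χ p.2 := rfl

/-- Support: `sharpCoeff(d) = 0` for `d ≥ D > 1` (`ψ_{≤D}(d) = ψ(log_D d)` and `ψ = 0` on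
`[1, ∞)`). [cite: TaoTeravainen2021, §2.5 (2.12) and §6] -/
theorem sharpCoeff_eq_zero_of_le {q : ℕ} (χ : DirichletCharacter ℂ q) {ψ : ℝ → ℝ}
    (hψ : IsSmoothCutoff ψ) (R : ℝ) {D : ℝ} (hD : 1 < D) {d : ℕ} (hd : D ≤ d) :
    sharpCoeff χ ψ R D d = 0 := by
  unfold sharpCoeff
  split_ifs
  · have hlogD : 0 < Real.log D := Real.log_pos hD
    have h1 : 1 ≤ Real.log d / Real.log D := by
      rw [le_div_iff₀ hlogD, one_mul]
      exact Real.log_le_log (by linarith) hd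
    rw [hψ.eq_zero _ (h1.trans (le_abs_self _)), mul_zero]
  · rfl

/-- `|(λ ∗ μχ)(d)| ≤ τ(d)`. [folklore] -/
theorem abs_lamMuChi_le {q : ℕ} (χ : DirichletCharacter ℂ q) (d : ℕ) :
    |lamMuChi χ d| ≤ #d.divisors := by
  unfold lamMuChi
  rw [card_divisors_eq_sum_antidiagonal]
  refine (abs_sum_le_sum_abs _ _).trans (sum_le_sum fun p _ => ?_)
  rw [abs_mul, abs_mul]
  have h1 := Literature.NumberTheory.Sieve.abs_liouville_le_one p.1
  have h2 : |(ArithmeticFunction.moebius p.2 : ℝ)| ≤ 1 := by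
    exact_mod_cast ArithmeticFunction.abs_moebius_le_one
  have h3 := abs_realChar_le_one χ p.2
  calc |(ArithmeticFunction.liouville p.1 : ℝ)| * |(ArithmeticFunction.moebius p.2 : ℝ)| *
        |realChar χ p.2| ≤ 1 * 1 * 1 := by
        gcongr
    _ = 1 := by ring

/-- Size: `|sharpCoeff(d)| ≤ M τ(d)` when `|ψ| ≤ M`. [cite: TaoTeravainen2021, §8 ("`‖h_d‖_TV ≪ τ(d₁)^{O(1)}⋯`")] -/
theorem abs_sharpCoeff_le {q : ℕ} (χ : DirichletCharacter ℂ q) {ψ : ℝ → ℝ} {M : ℝ}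
    (hM : ∀ u, |ψ u| ≤ M) (R D : ℝ) (d : ℕ) :
    |sharpCoeff χ ψ R D d| ≤ M * #d.divisors := by
  have hM0 : 0 ≤ M := (abs_nonneg _).trans (hM 0)
  unfold sharpCoeff
  split_ifs
  · rw [abs_mul, mul_comm]
    exact mul_le_mul (hM _) (abs_lamMuChi_le χ d) (abs_nonneg _) hM0
  · rw [abs_zero]; positivity

/-- A bound `M ≥ 1` for the smooth cutoff: `|ψ| ≤ M` (continuous, vanishing off `[-1, 1]`). [folklore] -/
theorem IsSmoothCutoff.exists_bound {ψ : ℝ → ℝ} (hψ : IsSmoothCutoff ψ) :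
    ∃ M : ℝ, 1 ≤ M ∧ ∀ u, |ψ u| ≤ M := by
  obtain ⟨C, hC⟩ := (isCompact_Icc (a := (-1 : ℝ)) (b := 1)).exists_bound_of_continuousOn
    (hψ.contDiff.continuous.continuousOn)
  refine ⟨max C 1, le_max_right _ _, fun u => ?_⟩
  by_cases hu : u ∈ Set.Icc (-1 : ℝ) 1
  · exact ((Real.norm_eq_abs _).symm.le.trans (hC u hu)).trans (le_max_left _ _)
  · rw [Set.mem_Icc, not_and_or, not_le, not_le] at hu
    have h1 : 1 ≤ |u| := by
      rcases hu with h | h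
      · rw [abs_of_neg (by linarith)]; linarith
      · rw [abs_of_pos (by linarith)]; linarith
    rw [hψ.eq_zero u h1, abs_zero]
    exact zero_le_one.trans (le_max_right _ _)

/-! ### The truncated divisor expansion of `λ♯_Siegel` -/

/-- **Truncated expansion**: for `m ≠ 0`, `D > 1` and `N + 1 ≥ D`,
`λ♯_Siegel(m) = ∑_{1 ≤ d ≤ N} 1_{d ∣ m} sharpCoeff(d) χ(m/d)` (the coefficient vanishes for
`d ≥ D`). [cite: TaoTeravainen2021, §6 (6.2) and §8] -/
theorem liouvilleSiegelSharp_eq_sum_Ioc {q : ℕ} (χ : DirichletCharacter ℂ q) {ψ : ℝ → ℝ}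
    (hψ : IsSmoothCutoff ψ) (R : ℝ) {D : ℝ} (hD : 1 < D) {N : ℕ} (hN : D ≤ N + 1) {m : ℕ}
    (hm : m ≠ 0) :
    liouvilleSiegelSharp χ ψ R D m =
      ∑ d ∈ Ioc 0 N, (if d ∣ m then sharpCoeff χ ψ R D d * realChar χ (m / d) else 0) := by
  rw [liouvilleSiegelSharp_eq_sum_sharpCoeff,
    Nat.sum_divisorsAntidiagonal (f := fun a b => sharpCoeff χ ψ R D a * realChar χ b),
    ← Finset.sum_filter]
  symm
  refine Finset.sum_subset (fun d hd => ?_) (fun d hd hd' => ?_)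
  · rw [mem_filter, mem_Ioc] at hd
    exact Nat.mem_divisors.mpr ⟨hd.2, hm⟩
  · -- a divisor `d > N` of `m`: the coefficient vanishes
    rw [Nat.mem_divisors] at hd
    rw [mem_filter, mem_Ioc, not_and_or] at hd'
    have hdN : N < d := by
      rcases hd' with h | h
      · rw [not_and_or, not_lt, not_le] at h
        rcases h with h | h
        · exact absurd h (by have := Nat.pos_of_dvd_of_pos hd.1 (Nat.pos_of_ne_zero hm); omega)
        · exact h
      · exact absurd hd.1 h
    have hDd : D ≤ d := hN.trans (by exact_mod_cast hdN)
    rw [sharpCoeff_eq_zero_of_le χ hψ R hD hDd, zero_mul]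

/-- Pointwise: `1_{c} (a b) = a · 1_{c} b`. [folklore] -/
theorem ite_mul_eq_mul_ite (c : Prop) [Decidable c] (a b : ℝ) :
    (if c then a * b else 0) = a * (if c then b else 0) := by
  split_ifs <;> simp

/-- **Expansion of the correlation into Type I sums** (§8, case `ℓ > 0`, at `k = 0`): for
`D > 1`, `N + 1 ≥ D` and shifts `h ≥ 1`,
`∑_{n=1}^{x} ∏_{h ∈ H} λ♯_Siegel(n+h) = ∑_{(d_h) ∈ [1,N]^H} (∏_h sharpCoeff(d_h)) ·
∑_{n=1}^{x} ∏_h 1_{d_h ∣ n+h} χ((n+h)/d_h)`. [cite: TaoTeravainen2021, §8 (expansion via (6.2))] -/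
theorem sum_prod_liouvilleSiegelSharp_eq {q : ℕ} (χ : DirichletCharacter ℂ q) {ψ : ℝ → ℝ}
    (hψ : IsSmoothCutoff ψ) (R : ℝ) {D : ℝ} (hD : 1 < D) {N : ℕ} (hN : D ≤ N + 1)
    (H : Finset ℕ) (x : ℕ) :
    ∑ n ∈ Icc 1 x, ∏ h ∈ H, liouvilleSiegelSharp χ ψ R D (n + h) =
      ∑ p ∈ H.pi (fun _ => Ioc 0 N),
        (∏ a ∈ H.attach, sharpCoeff χ ψ R D (p a.1 a.2)) *
          ∑ n ∈ Icc 1 x, ∏ a ∈ H.attach,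
            (if p a.1 a.2 ∣ n + a.1 then realChar χ ((n + a.1) / p a.1 a.2) else 0) := by
  classical
  have hstep : ∀ n ∈ Icc 1 x, ∏ h ∈ H, liouvilleSiegelSharp χ ψ R D (n + h) =
      ∑ p ∈ H.pi (fun _ => Ioc 0 N), ∏ a ∈ H.attach,
        (if p a.1 a.2 ∣ n + a.1 then
          sharpCoeff χ ψ R D (p a.1 a.2) * realChar χ ((n + a.1) / p a.1 a.2) else 0) := by
    intro n hn
    rw [mem_Icc] at hn
    rw [← Finset.prod_sum H (fun _ => Ioc 0 N) (fun h d =>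
      if d ∣ n + h then sharpCoeff χ ψ R D d * realChar χ ((n + h) / d) else 0)]
    refine prod_congr rfl fun h _ => ?_
    exact liouvilleSiegelSharp_eq_sum_Ioc χ hψ R hD hN (by omega)
  rw [sum_congr rfl hstep, sum_comm]
  refine sum_congr rfl fun p _ => ?_
  rw [mul_sum]
  refine sum_congr rfl fun n _ => ?_
  rw [← prod_mul_distrib]
  refine prod_congr rfl fun a _ => ?_
  exact ite_mul_eq_mul_ite _ _ _

/-- The tuple `(p_h)_{h ∈ H}` of a `Finset.pi` element as a function on `ℕ` (value `1` off `H`).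
[folklore] -/
def piFun (H : Finset ℕ) (p : ∀ h ∈ H, ℕ) (h : ℕ) : ℕ :=
  if hh : h ∈ H then p h hh else 1

/-- On `H.attach`, `piFun H p a = p a`. [folklore] -/
theorem piFun_apply (H : Finset ℕ) (p : ∀ h ∈ H, ℕ) (a : {h // h ∈ H}) :
    piFun H p a.1 = p a.1 a.2 := by
  simp [piFun, a.2]

/-- A product over `H.attach` of a function of `(a, p a)` is the product over `H` of the same
function of `(h, piFun H p h)`. [folklore] -/
theorem prod_attach_eq_prod_piFun {β : Type*} [CommMonoid β] (H : Finset ℕ) (p : ∀ h ∈ H, ℕ)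
    (g : ℕ → ℕ → β) :
    ∏ a ∈ H.attach, g a.1 (p a.1 a.2) = ∏ h ∈ H, g h (piFun H p h) := by
  rw [← Finset.prod_attach H (fun h => g h (piFun H p h))]
  refine prod_congr rfl fun a _ => ?_
  rw [piFun_apply]

/-- Elements of `H.pi (fun _ => Ioc 0 N)` have coordinates in `[1, N]`. [folklore] -/
theorem piFun_mem {H : Finset ℕ} {N : ℕ} {p : ∀ h ∈ H, ℕ} (hp : p ∈ H.pi fun _ => Ioc 0 N)
    {h : ℕ} (hh : h ∈ H) : 1 ≤ piFun H p h ∧ piFun H p h ≤ N := by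
  rw [Finset.mem_pi] at hp
  have := hp h hh
  rw [mem_Ioc] at this
  simp only [piFun, dif_pos hh]
  omega

end TaoTeravainen

end Literature.Barriers.Parity
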